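import Literature.MathematicalPhysics.QuantumFieldTheory.Balaban1983to89.B9Cor35ComparisonsGpCAtLetters
import Literature.MathematicalPhysics.QuantumFieldTheory.Balaban1983to89.B9Ineq347GpFlatMultiLevelTorus
import Literature.MathematicalPhysics.QuantumFieldTheory.Balaban1983to89.B9ResidualEntriesAtOneAtLetters

/-!
# `Balaban1983to89.B9Ineq347GpAtLetters` — [B9] (3.47) AT U = 1 FOR G′(1) AT NODE 00's OPERATOR LAYER OF LETTERS: the (3.47) LEAF OF THE
# RESIDUAL ROW `hGp` of the N06 knit is a THEOREM at `ops := Node00.opsYOfLetters N θ M⋆ 𝔏 𝔈`, for EVERY letter record `𝔏` — from [4]'s local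
# majorants (2.67) and Lemma 2.1 on the genuine k-level torus (lit-balaban-p21's `B9Ineq347GpFlatMultiLevelTorus`), exactly as print says

T. Bałaban, *Propagators for lattice gauge theories in a background field*, Commun. Math. Phys. **99** (1985) 389–434
[`Balaban1985BackgroundPropagators`, "B9"]; [4] = T. Bałaban, *Propagators and renormalization transformations for lattice
gauge theories. II*, Commun. Math. Phys. **96** (1984) 223–250 [`Balaban1984PropagatorsII`].

statement-level skeleton of published theorems with citation tags; proofs where landed; nothing here is a claim about the
Yang–Mills mass gap

THE PRINTED LOCI (verbatim).  Thm 3.1, p. 398: *"and the global inequalities |G′(U)λ|_{(2+γ)}, |∇_UG′(U)λ|_{(1+γ)}, |G′(U)∇*_Uλ|_{(1+γ)},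
|∇_UG′(U)λ|_{(γ)} ≦ B₀|λ|_{(γ)} (3.47) for γ in a fixed compact subset of real numbers, e.g. for γ ∈ [−4, 4]"* (fourth member read `Δ_U`,
census G-B9-01), with (3.41) *"|λ|_{(α)} = sup_j sup_{x ∈ Ω_j∖Ω_{j+1}} (Lʲη)^{−α}|λ(x)|"*; p. 398: *"It is easy to see that the global inequalities
(3.47) are consequences of the local ones (3.42) and Lemma 2.1."*; Cor. 3.5, p. 407: *"For operators with the external gauge field
configuration U = 1, these theorems are proved in [4]"*; p. 395: *"It coincides with Δ_a in (2.19) if U = 1"*.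

THE POINT.  Row 11 of the N06 knit (`hGp : B9FromB6.ResidualGpAtOne geo9Y (bg9Y …) (fun x => (ops x).Gp)` — the five entries (3.43)Δ̃ ∕ (3.44) ∕
(3.45) ∕ (3.46) ∕ (3.47) of G′(1) that [4] does not print) is, AT NODE 00's layer of letters, EQUIVALENT to its five per-block U = 1 leaves ON SITE
ARGUMENTS (`B9ResidualEntriesAtOneAtLetters.residualGpAtOne_letters_iff_blocksOn`).  THIS FILE PROVES ONE OF THE FIVE — the (3.47) leaf
`AtOneGlobOn … (fun x => (operatorLayerYOfLetters 𝔸 G x (𝔏 x) (𝔈 x)).Gp) (fun _ lam => ¬ lam.isRight)` — for EVERY letter record `𝔏` (def-Y's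
interface `Node00.CovLettersY` with its printed `U = 1` clause `Gp_one`): at `U = 1` the reading `kernelFamilyS` of G′ on a product-form argument
`f ⊗ E` is, entry by entry, the (3.41)-weighted supremum of the LIFT of `η²·G′f`, `η·∂_μG′f`, `η·G′∂_μᵀf`, `(−Δ_T)G′f` (n06-f's flat calculus on
lifts `cdS_one_liftY` ∕ `cdsS_one_liftY` ∕ `lapS_one_liftY`, def-Y's `norm_liftY_le`), `G′ = KTIdx.G = Δ′_a⁻¹` NODE 00's genuine k-level torus
operator with the printed weights; and for THAT operator lit-balaban-p21 proved (3.47) at U = 1 in lattice units on the whole k-level torus family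
(`B9Ineq347GpFlatMultiLevelTorus.ineq347_Gp_flat_multiLevelTorus`: the block majorants (2.67) of [4] Prop. 2.2 + the weight transfer (2.60) + the
row sum (2.61), all DISCHARGED on the torus).  The members of record live in print's units `c_f = L^k` (`MemberY.hcfk`), so the reading's `η = L^{−k}`
(`Node00.etaS`) IS the `η = |c_f|⁻¹` of the (3.41) weights (`etaS_toKIdx`), and the lattice-unit statement becomes the printed one.

* §1 scalar bookkeeping: `scale_rpow_split` ∕ `scale_rpow_split₀` (`(Lʲη)^{n+γ} = L^{nj}ηⁿ·L^{γj}η^γ`), `abs_le_wNormS_mul_scale` (print's pointwise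
  form of `|f|_{(γ)}`: `|f(z)| ≤ |f|_{(γ)}·(L^{j(z)}η)^γ`), `wNormSY_le_of_pointwise` (the converse for `𝔸`-valued functions).
* §2 ★ `ineq347_Gp_kIdx` — (3.47) AT U = 1 FOR `KTIdx.G` AT EVERY k-LEVEL INDEX ABOVE A THRESHOLD, PRINT'S UNITS, POINTWISE FORM: for every `γ₀` there
  are `M₁, C > 0` with, for `M = L·M_h ≥ M₁`, `|γ| ≤ γ₀`, all `f`, `z` (level `j(z)`), `η = |c_f|⁻¹`: `η²|(G′f)(z)| ≤ C|f|_{(γ)}(L^{j}η)^{2+γ}`,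
  `η|(∂_μG′f)(z)|, η|(G′∂_μᵀf)(z)| ≤ C|f|_{(γ)}(L^{j}η)^{1+γ}`, `|((−Δ_T)G′f)(z)| ≤ C|f|_{(γ)}(L^{j}η)^{γ}` — p21's theorem at `KIdx.aPrinted_windows`,
  instantiated as T8's `prop22_supEntries_kLevelTorus` instantiates Prop. 2.2.
* §3 at a site-sector letter `O` with the flatness clause and `etaS i = |c_f|⁻¹`: `glob0_one_le` … `glob3_one_le` (each (3.47) member of the reading at
  U = 1 on `f ⊗ E`, `‖E‖ ≤ 1`, is `≤ C|f|_{(γ)}` given §2's pointwise bounds).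
* §4 at a member: `etaS_toKIdx`, `Gp_glob_one_inl` (`rfl` unfolding), ★ `Gp_glob_one_inl_le`.
* §5 ★★ `atOneGlobOn_Gp_letters` — THE (3.47) LEAF OF G′(1) ON SITE ARGUMENTS HOLDS at the layer of letters, every `𝔏 𝔈` (γ ∈ [−4, 4], one threshold,
  one B₀); ★ `residualGlobAtOne_Gp_letters` (the unrestricted (3.47) block of G′(1), `B9FromB6.ResidualGAGlobAtOne`-shape, via the OFF-summand nulls
  of `B9ResidualEntriesAtOneAtLetters`); ★★ `residualGpAtOne_letters_of_blocksOn4` — ROW 11 at the layer ⇐ the FOUR remaining leaves (3.46) ∕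
  (3.43)Δ̃ ∕ (3.44) ∕ (3.45); record faces ★★ `atOneGlobOn_Gp_opsYOfLetters`, ★★ `hGp_opsYOfLetters_of_blocksOn4` (binder type verbatim).

HONEST SCOPE.  ONE leaf of row 11 is discharged at the layer of letters — print's «easy» sentence, whose content ([4] (2.67) + Lemma 2.1 on the
torus) was proved by lit-balaban-p21 and is only READ here; the other four leaves ((3.46), (3.43) with Δ̃-cut-offs, (3.44), (3.45) for G′(1):
G-B9-03a ∕ G-B9-20, not printed in [4]) and row 12's leaf for G(1) remain displayed hypotheses.  The letters are NOT constructed (def-Y's successor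
`lettersYOfRecord`); nothing of [B9] beyond the cited sentence is asserted; count-neutral; N06 NOT discharged; one finite lattice programme —
nothing continuum, nothing about the mass gap.  Cell `pub-ymgap` (HUMAN RULING D-0062), Track A node N06 [B9], N06-ASSIGNMENT v1 row 11 (bundle F3)
at def-Y's instance, seat `pub-ymgap-dag-n06-h` (g2), 2026-08-26.
-/

noncomputable section

namespace Literature.MathematicalPhysics.QuantumFieldTheory.Balaban1983to89.B9Ineq347GpAtLetters

open B6MultiLevelBoxOperator (aPrinted)
open B6MultiLevelTorusOperator (perLapT)
open B6Prop22DerivMultiLevelTorus (dT)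
open B6Geom246MultiLevelBox (blkOf)
open B6KLevelCensusIndexV1 (KIdx kGeo)
open B6Prop22KLevelTorusCensus (KTIdx)
open B6Prop22KLevelTorusCensusEta (nKT)
open B8ScaledSupNorm (msup_le_of_pointwise norm_le_of_msup_le)
open B9GeoNormsKLevelV1 (geo9K wNormS wNormU bddS wNormS_nonneg blkOf_level_le)
open B9Ineq347GpFlatMultiLevelTorus (ineq347_Gp_flat_multiLevelTorus)
open B9Cor35ComparisonsGpCAtLetters (cdS_one_liftY cdsS_one_liftY lapS_one_liftY real_smul_liftY_apply)
open B9FromB6 (ResidualGpAtOne ResidualGAGlobAtOne)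
open B9ResidualEntriesAtOne (AtOneGlobOn GlobBlockOn AtOneL2On AtOneH1On AtOneE4On AtOneH2On residualGAGlobAtOne_of_globOn_of_null)
open B9ResidualEntriesAtOneAtLetters (residualGpAtOne_letters_of_blocksOn Gp_glob_nonpos_of_isRight)
open B9PinMembersKLevelV1 (MemberY geo9Y bg9Y)
open B7Prop2SpecialUnitary (specialUnitaryUnits)
open Node00
open scoped Matrix

variable {d ℓ : ℕ} {hd : 1 ≤ d + 1} {hL : Odd (ℓ + 1) ∧ 1 < ℓ + 1} {b₀ b₁ : ℝ} {Mstar : ℕ}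
variable {𝔸 : Type} [NormedRing 𝔸] [NormedAlgebra ℂ 𝔸] [CompleteSpace 𝔸]

/-! ## §1 Scalar bookkeeping: the (3.41) weights in pointwise form -/

section Scalar

/-- splitting the scale power of (3.41): `(Lʲη)^{n+γ} = (L^{nj}ηⁿ)·(L^{γj}η^γ)` (`L, η > 0`).
[cite: Balaban1985BackgroundPropagators, (3.41) p.397 + p.398 (remark after Thm 3.1: «(Lʲη)^α = (Lʲη)^β(Lʲη)^γ»), bookkeeping] -/
theorem scale_rpow_split {L η : ℝ} (hLpos : 0 < L) (hη : 0 < η) (j n : ℕ) (γ : ℝ) :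
    (L ^ j * η) ^ ((n : ℝ) + γ) = L ^ (n * j) * η ^ n * (L ^ (γ * (j : ℝ)) * η ^ γ) := by
  rw [Real.rpow_add (mul_pos (pow_pos hLpos j) hη), Real.rpow_natCast, mul_pow, ← pow_mul',
    Real.mul_rpow (pow_nonneg hLpos.le j) hη.le, ← Real.rpow_natCast L j, ← Real.rpow_mul hLpos.le, mul_comm (j : ℝ) γ]

/-- the case `n = 0`: `(Lʲη)^γ = L^{γj}·η^γ`. [cite: Balaban1985BackgroundPropagators, (3.41) p.397, bookkeeping] -/
theorem scale_rpow_split₀ {L η : ℝ} (hLpos : 0 < L) (hη : 0 < η) (j : ℕ) (γ : ℝ) :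
    (L ^ j * η) ^ γ = L ^ (γ * (j : ℝ)) * η ^ γ := by
  rw [Real.mul_rpow (pow_nonneg hLpos.le j) hη.le, ← Real.rpow_natCast L j, ← Real.rpow_mul hLpos.le, mul_comm (j : ℝ) γ]

variable (i : KIdx d ℓ hd hL b₀ b₁)

/-- **print's pointwise form of (3.41)**: `|f(z)| ≤ |f|_{(γ)}·(L^{j(z)}η)^γ`, `j(z)` the level of the block of `z`, `η = |c_f|⁻¹`.
[cite: Balaban1985BackgroundPropagators, (3.41) p.397] -/
theorem abs_le_wNormS_mul_scale (γ : ℝ) (f : SiteY i → ℝ) (z : SiteY i) :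
    |f z| ≤ wNormS i γ f * (((ℓ : ℝ) + 1) ^ (i.D.lev z.1) * |i.cf|⁻¹) ^ γ := by
  have h := norm_le_of_msup_le (Nat.succ_le_succ (Nat.zero_le ℓ) : 1 ≤ ℓ + 1) (inv_pos.2 (abs_pos.2 i.hcf)) (bddS i γ f)
    (le_refl (wNormS i γ f)) (blkOf_level_le i z) rfl
  have hlev : (blkOf i.D.toDomains z).1.1 = i.D.lev z.1 := rfl
  rw [Real.norm_eq_abs, hlev] at h
  push_cast at h
  exact h

omit [NormedAlgebra ℂ 𝔸] [CompleteSpace 𝔸] in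
/-- **the converse for `𝔸`-valued site functions**: a pointwise bound `‖Ψ(z)‖ ≤ c·(L^{j(z)}η)^α` (`c ≥ 0`) gives `|Ψ|_{(α)} ≤ c` (def-Y's `wNormSY`).
[cite: Balaban1985BackgroundPropagators, (3.41) p.397] -/
theorem wNormSY_le_of_pointwise {α c : ℝ} (hc : 0 ≤ c) {Ψ : SiteY i → 𝔸}
    (h : ∀ z : SiteY i, ‖Ψ z‖ ≤ c * (((ℓ : ℝ) + 1) ^ (i.D.lev z.1) * |i.cf|⁻¹) ^ α) : wNormSY i α Ψ ≤ c := by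
  unfold wNormSY
  refine msup_le_of_pointwise (Nat.succ_le_succ (Nat.zero_le ℓ)) (inv_pos.2 (abs_pos.2 i.hcf)) hc fun j _ z hz => ?_
  have hj : i.D.lev z.1 = j := hz
  have h' := h z
  rw [hj] at h'
  push_cast
  exact h'

end Scalar

/-! ## §2 (3.47) at U = 1 for NODE 00's `G′ = KTIdx.G` at every k-level index, print's units, pointwise form -/

section KLevel

/-- ★ **(3.47) AT `U = 1` FOR `G′ = Δ′_a⁻¹` (T8's `KTIdx.G`, printed weights) AT EVERY k-LEVEL V1 INDEX ABOVE A THRESHOLD — PRINT'S UNITS, POINTWISE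
FORM.**  For every `γ₀` there are `M₁, C > 0` such that for every index `i` with `M = L·M_h ≥ M₁`, every real `γ` with `|γ| ≤ γ₀`, every `f` and every
site `z` (level `j(z)`, `η = |c_f|⁻¹`): `η²|(G′f)(z)| ≤ C|f|_{(γ)}(L^{j}η)^{2+γ}`, `η|(∂_μG′f)(z)| ≤ C|f|_{(γ)}(L^{j}η)^{1+γ}`,
`η|(G′∂_μᵀf)(z)| ≤ C|f|_{(γ)}(L^{j}η)^{1+γ}` (all `μ`), `|((−Δ_T)G′f)(z)| ≤ C|f|_{(γ)}(L^{j}η)^{γ}` — i.e. `|η²G′f|_{(2+γ)}, |η∂_μG′f|_{(1+γ)},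
|ηG′∂_μᵀf|_{(1+γ)}, |ΔG′f|_{(γ)} ≤ C|f|_{(γ)}` read pointwise.  lit-balaban-p21's `ineq347_Gp_flat_multiLevelTorus` ((2.67) + Lemma 2.1 on the
genuine torus, lattice units) at the printed weights `KIdx.aPrinted_windows`, `N := |f|_{(γ)}·η^γ`, rescaled by `scale_rpow_split`.
[cite: Balaban1985BackgroundPropagators, Thm 3.1 (3.47) + (3.41) pp.397–398; Balaban1984PropagatorsII, Prop. 2.2 (2.67), Lemma 2.1 (2.60)–(2.61) p.234] -/
theorem ineq347_Gp_kIdx (γ₀ : ℝ) : ∃ M₁ C : ℝ, 0 < M₁ ∧ 0 < C ∧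
    ∀ i : KIdx d ℓ hd hL b₀ b₁, M₁ ≤ (kGeo i).M → ∀ γ : ℝ, |γ| ≤ γ₀ → ∀ (f : SiteY i → ℝ) (z : SiteY i),
      |i.cf|⁻¹ ^ 2 * |((toKT i).G *ᵥ f) z| ≤
          C * wNormS i γ f * (((ℓ : ℝ) + 1) ^ (i.D.lev z.1) * |i.cf|⁻¹) ^ ((2 : ℝ) + γ) ∧
      (∀ μ : Fin (d + 1), |i.cf|⁻¹ * |((dT (toKT i).NB μ * (toKT i).G) *ᵥ f) z| ≤
          C * wNormS i γ f * (((ℓ : ℝ) + 1) ^ (i.D.lev z.1) * |i.cf|⁻¹) ^ ((1 : ℝ) + γ)) ∧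
      (∀ μ : Fin (d + 1), |i.cf|⁻¹ * |(((toKT i).G * (dT (toKT i).NB μ)ᵀ) *ᵥ f) z| ≤
          C * wNormS i γ f * (((ℓ : ℝ) + 1) ^ (i.D.lev z.1) * |i.cf|⁻¹) ^ ((1 : ℝ) + γ)) ∧
      |((perLapT (toKT i).NB * (toKT i).G) *ᵥ f) z| ≤
          C * wNormS i γ f * (((ℓ : ℝ) + 1) ^ (i.D.lev z.1) * |i.cf|⁻¹) ^ γ := by
  by_cases hℓ : 1 ≤ ℓ
  swap
  · exact ⟨1, 1, one_pos, one_pos, fun i => absurd (le_trans (by norm_num) i.hℓ) hℓ⟩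
  have hL0 : (0 : ℝ) < (ℓ : ℝ) + 1 := by positivity
  have hL2 : (1 : ℝ) < ((ℓ : ℝ) + 1) ^ 2 := by
    have h1 : (1 : ℝ) ≤ ℓ := by exact_mod_cast hℓ
    nlinarith
  have hamin : 0 < 1 - ((((ℓ : ℝ) + 1)) ^ 2)⁻¹ := by
    rw [sub_pos]
    exact inv_lt_one_of_one_lt₀ hL2
  obtain ⟨hwin, hrec⟩ := B6Prop22KLevelCensus.KIdx.aPrinted_windows hℓ
  obtain ⟨C, M₀, N₀, hC, hM₀, -, H⟩ :=
    ineq347_Gp_flat_multiLevelTorus d ℓ hℓ (1 - ((((ℓ : ℝ) + 1)) ^ 2)⁻¹) 1 1 1 hamin one_pos γ₀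
  refine ⟨max M₀ ((N₀ : ℝ) + 1), C, lt_max_of_lt_left hM₀, hC, ?_⟩
  intro i hM γ hγ f z
  have hM' : max M₀ ((N₀ : ℝ) + 1) ≤ ((ℓ : ℝ) + 1) * i.Mh := by
    have hMdef : (kGeo i).M = (((ℓ + 1 : ℕ) : ℝ)) * (i.Mh : ℝ) := rfl
    rw [hMdef] at hM
    push_cast at hM
    exact hM
  have hMh3 : 3 ≤ i.Mh := le_trans (by norm_num) i.hM8
  have hM₀' : M₀ ≤ ((ℓ : ℝ) + 1) * i.Mh := (le_max_left _ _).trans hM'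
  have hRN : N₀ + 1 ≤ i.R * ((ℓ + 1) * i.Mh) := by
    have h1 : ((N₀ : ℝ) + 1) ≤ ((ℓ : ℝ) + 1) * i.Mh := (le_max_right _ _).trans hM'
    have h2 : N₀ + 1 ≤ (ℓ + 1) * i.Mh := by exact_mod_cast h1
    have hR1 : 1 ≤ i.R := le_trans (by omega) (toKT i).hR
    calc N₀ + 1 ≤ 1 * ((ℓ + 1) * i.Mh) := by rw [one_mul]; exact h2
      _ ≤ i.R * ((ℓ + 1) * i.Mh) := Nat.mul_le_mul_right _ hR1
  have hη : 0 < |i.cf|⁻¹ := inv_pos.2 (abs_pos.2 i.hcf)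
  have hN : 0 ≤ wNormS i γ f := wNormS_nonneg i γ f
  have hlam : ∀ w : SiteY i, |f w| ≤ ((ℓ : ℝ) + 1) ^ (γ * (i.D.lev w.1 : ℝ)) * (wNormS i γ f * |i.cf|⁻¹ ^ γ) := by
    intro w
    have h := abs_le_wNormS_mul_scale i γ f w
    rw [scale_rpow_split₀ hL0 hη] at h
    calc |f w| ≤ _ := h
      _ = _ := by ring
  obtain ⟨h0, h1, h2, h3⟩ := H i.k i.Mh i.R hMh3 hM₀' (toKT i).hR hRN i.P' (toKT i).hP (toKT i).hP4 i.D (aPrinted ℓ 1)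
    (fun _ => 1) hwin (fun j _ => ⟨le_rfl, le_rfl⟩) hrec γ hγ f (wNormS i γ f * |i.cf|⁻¹ ^ γ) (by positivity) hlam z
  -- the four conclusions are about `gmlT … (aPrinted ℓ 1) = (toKT i).G` (definitionally)
  have h0' : |((toKT i).G *ᵥ f) z| ≤ C * ((ℓ : ℝ) + 1) ^ (2 * i.D.lev z.1) * ((ℓ : ℝ) + 1) ^ (γ * (i.D.lev z.1 : ℝ)) *
      (wNormS i γ f * |i.cf|⁻¹ ^ γ) := h0
  have h1' : ∀ μ : Fin (d + 1), |((dT (toKT i).NB μ * (toKT i).G) *ᵥ f) z| ≤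
      C * ((ℓ : ℝ) + 1) ^ (i.D.lev z.1) * ((ℓ : ℝ) + 1) ^ (γ * (i.D.lev z.1 : ℝ)) * (wNormS i γ f * |i.cf|⁻¹ ^ γ) := h1
  have h2' : ∀ μ : Fin (d + 1), |(((toKT i).G * (dT (toKT i).NB μ)ᵀ) *ᵥ f) z| ≤
      C * ((ℓ : ℝ) + 1) ^ (i.D.lev z.1) * ((ℓ : ℝ) + 1) ^ (γ * (i.D.lev z.1 : ℝ)) * (wNormS i γ f * |i.cf|⁻¹ ^ γ) := h2
  have h3' : |((perLapT (toKT i).NB * (toKT i).G) *ᵥ f) z| ≤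
      C * ((ℓ : ℝ) + 1) ^ (γ * (i.D.lev z.1 : ℝ)) * (wNormS i γ f * |i.cf|⁻¹ ^ γ) := h3
  -- the scale powers
  have e2 : (((ℓ : ℝ) + 1) ^ (i.D.lev z.1) * |i.cf|⁻¹) ^ ((2 : ℝ) + γ) =
      ((ℓ : ℝ) + 1) ^ (2 * i.D.lev z.1) * |i.cf|⁻¹ ^ 2 * (((ℓ : ℝ) + 1) ^ (γ * (i.D.lev z.1 : ℝ)) * |i.cf|⁻¹ ^ γ) := by
    have h := scale_rpow_split hL0 hη (i.D.lev z.1) 2 γ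
    push_cast at h
    exact h
  have e1 : (((ℓ : ℝ) + 1) ^ (i.D.lev z.1) * |i.cf|⁻¹) ^ ((1 : ℝ) + γ) =
      ((ℓ : ℝ) + 1) ^ (i.D.lev z.1) * |i.cf|⁻¹ * (((ℓ : ℝ) + 1) ^ (γ * (i.D.lev z.1 : ℝ)) * |i.cf|⁻¹ ^ γ) := by
    have h := scale_rpow_split hL0 hη (i.D.lev z.1) 1 γ
    push_cast at h
    simpa only [one_mul, pow_one] using h
  have e0 : (((ℓ : ℝ) + 1) ^ (i.D.lev z.1) * |i.cf|⁻¹) ^ γ = ((ℓ : ℝ) + 1) ^ (γ * (i.D.lev z.1 : ℝ)) * |i.cf|⁻¹ ^ γ :=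
    scale_rpow_split₀ hL0 hη (i.D.lev z.1) γ
  refine ⟨?_, fun μ => ?_, fun μ => ?_, ?_⟩
  · rw [e2]
    calc |i.cf|⁻¹ ^ 2 * |((toKT i).G *ᵥ f) z|
        ≤ |i.cf|⁻¹ ^ 2 * (C * ((ℓ : ℝ) + 1) ^ (2 * i.D.lev z.1) * ((ℓ : ℝ) + 1) ^ (γ * (i.D.lev z.1 : ℝ)) *
            (wNormS i γ f * |i.cf|⁻¹ ^ γ)) := mul_le_mul_of_nonneg_left h0' (pow_nonneg hη.le 2)
      _ = _ := by ring
  · rw [e1]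
    calc |i.cf|⁻¹ * |((dT (toKT i).NB μ * (toKT i).G) *ᵥ f) z|
        ≤ |i.cf|⁻¹ * (C * ((ℓ : ℝ) + 1) ^ (i.D.lev z.1) * ((ℓ : ℝ) + 1) ^ (γ * (i.D.lev z.1 : ℝ)) *
            (wNormS i γ f * |i.cf|⁻¹ ^ γ)) := mul_le_mul_of_nonneg_left (h1' μ) hη.le
      _ = _ := by ring
  · rw [e1]
    calc |i.cf|⁻¹ * |(((toKT i).G * (dT (toKT i).NB μ)ᵀ) *ᵥ f) z|
        ≤ |i.cf|⁻¹ * (C * ((ℓ : ℝ) + 1) ^ (i.D.lev z.1) * ((ℓ : ℝ) + 1) ^ (γ * (i.D.lev z.1 : ℝ)) *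
            (wNormS i γ f * |i.cf|⁻¹ ^ γ)) := mul_le_mul_of_nonneg_left (h2' μ) hη.le
      _ = _ := by ring
  · rw [e0]
    calc |((perLapT (toKT i).NB * (toKT i).G) *ᵥ f) z| ≤ _ := h3'
      _ = _ := by ring

end KLevel

/-! ## §3 At a site-sector letter with the printed `U = 1` clause: the four (3.47) members of the reading -/

section Letter

variable (i : KIdx d ℓ hd hL b₀ b₁) (O : SiteOpY 𝔸 i)
  (hO : ∀ (f : SiteY i → ℝ) (E : 𝔸), O (fun _ _ => 1) (liftY f E) = liftY ((toKT i).G *ᵥ f) E)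
  (hη : etaS i = |i.cf|⁻¹)
include hO hη

/-- **(3.47)₁ of the reading at `U = 1` on `f ⊗ E`**: `|η²·G′(1)(f ⊗ E)|_{(2+γ)} ≤ C|f|_{(γ)}` given §2's first pointwise bound (`‖E‖ ≤ 1`).
[cite: Balaban1985BackgroundPropagators, (3.47) p.398 + Cor. 3.5 p.407] -/
theorem glob0_one_le (f : SiteY i → ℝ) (E : BallY 𝔸) {γ C : ℝ} (hC : 0 ≤ C)
    (h0 : ∀ z : SiteY i, |i.cf|⁻¹ ^ 2 * |((toKT i).G *ᵥ f) z| ≤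
      C * wNormS i γ f * (((ℓ : ℝ) + 1) ^ (i.D.lev z.1) * |i.cf|⁻¹) ^ ((2 : ℝ) + γ)) :
    wNormSY i (2 + γ) (fun z => ((etaS i ^ 2 : ℝ) : ℂ) • O (fun _ _ => 1) (liftY f (E : 𝔸)) z) ≤ C * wNormS i γ f := by
  refine wNormSY_le_of_pointwise i (mul_nonneg hC (wNormS_nonneg i γ f)) fun z => ?_
  rw [hO, real_smul_liftY_apply, hη]
  calc ‖liftY (fun w => |i.cf|⁻¹ ^ 2 * ((toKT i).G *ᵥ f) w) (E : 𝔸) z‖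
      ≤ |(|i.cf|⁻¹ ^ 2 * ((toKT i).G *ᵥ f) z)| := norm_liftY_le _ E z
    _ = |i.cf|⁻¹ ^ 2 * |((toKT i).G *ᵥ f) z| := by
        rw [abs_mul, abs_of_nonneg (pow_nonneg (inv_nonneg.2 (abs_nonneg _)) 2)]
    _ ≤ _ := h0 z

/-- **(3.47)₂ of the reading at `U = 1` on `f ⊗ E`, direction `μ`**: `|η·∇_{1,μ}G′(1)(f ⊗ E)|_{(1+γ)} ≤ C|f|_{(γ)}` given §2's second bound.
[cite: Balaban1985BackgroundPropagators, (3.47) p.398 + (3.3) p.390 + Cor. 3.5 p.407] -/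
theorem glob1_one_le (f : SiteY i → ℝ) (E : BallY 𝔸) (μ : Fin (d + 1)) {γ C : ℝ} (hC : 0 ≤ C)
    (h1 : ∀ z : SiteY i, |i.cf|⁻¹ * |((dT (toKT i).NB μ * (toKT i).G) *ᵥ f) z| ≤
      C * wNormS i γ f * (((ℓ : ℝ) + 1) ^ (i.D.lev z.1) * |i.cf|⁻¹) ^ ((1 : ℝ) + γ)) :
    wNormSY i (1 + γ) (fun z => ((etaS i : ℝ) : ℂ) • cdS i (fun _ _ => 1) μ (O (fun _ _ => 1) (liftY f (E : 𝔸))) z) ≤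
      C * wNormS i γ f := by
  refine wNormSY_le_of_pointwise i (mul_nonneg hC (wNormS_nonneg i γ f)) fun z => ?_
  rw [hO, cdS_one_liftY, Matrix.mulVec_mulVec, real_smul_liftY_apply, hη]
  calc ‖liftY (fun w => |i.cf|⁻¹ * ((dT (toKT i).NB μ * (toKT i).G) *ᵥ f) w) (E : 𝔸) z‖
      ≤ |(|i.cf|⁻¹ * ((dT (toKT i).NB μ * (toKT i).G) *ᵥ f) z)| := norm_liftY_le _ E z
    _ = |i.cf|⁻¹ * |((dT (toKT i).NB μ * (toKT i).G) *ᵥ f) z| := by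
        rw [abs_mul, abs_of_nonneg (inv_nonneg.2 (abs_nonneg _))]
    _ ≤ _ := h1 z

/-- **(3.47)₃ of the reading at `U = 1` on `f ⊗ E`, direction `μ`**: `|η·G′(1)∇*_{1,μ}(f ⊗ E)|_{(1+γ)} ≤ C|f|_{(γ)}` given §2's third bound.
[cite: Balaban1985BackgroundPropagators, (3.47) p.398 + (3.8) p.392 + Cor. 3.5 p.407] -/
theorem glob2_one_le (f : SiteY i → ℝ) (E : BallY 𝔸) (μ : Fin (d + 1)) {γ C : ℝ} (hC : 0 ≤ C)
    (h2 : ∀ z : SiteY i, |i.cf|⁻¹ * |(((toKT i).G * (dT (toKT i).NB μ)ᵀ) *ᵥ f) z| ≤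
      C * wNormS i γ f * (((ℓ : ℝ) + 1) ^ (i.D.lev z.1) * |i.cf|⁻¹) ^ ((1 : ℝ) + γ)) :
    wNormSY i (1 + γ) (fun z => ((etaS i : ℝ) : ℂ) • O (fun _ _ => 1) (cdsS i (fun _ _ => 1) μ (liftY f (E : 𝔸))) z) ≤
      C * wNormS i γ f := by
  refine wNormSY_le_of_pointwise i (mul_nonneg hC (wNormS_nonneg i γ f)) fun z => ?_
  rw [cdsS_one_liftY, hO, Matrix.mulVec_mulVec, real_smul_liftY_apply, hη]
  calc ‖liftY (fun w => |i.cf|⁻¹ * (((toKT i).G * (dT (toKT i).NB μ)ᵀ) *ᵥ f) w) (E : 𝔸) z‖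
      ≤ |(|i.cf|⁻¹ * (((toKT i).G * (dT (toKT i).NB μ)ᵀ) *ᵥ f) z)| := norm_liftY_le _ E z
    _ = |i.cf|⁻¹ * |(((toKT i).G * (dT (toKT i).NB μ)ᵀ) *ᵥ f) z| := by
        rw [abs_mul, abs_of_nonneg (inv_nonneg.2 (abs_nonneg _))]
    _ ≤ _ := h2 z

omit hη in
/-- **(3.47)₄ of the reading at `U = 1` on `f ⊗ E`**: `|Δ_1G′(1)(f ⊗ E)|_{(γ)} ≤ C|f|_{(γ)}` given §2's fourth bound (no `η` prefactor: `hη` unused).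
[cite: Balaban1985BackgroundPropagators, (3.47) p.398 + (3.23) p.395 + Cor. 3.5 p.407] -/
theorem glob3_one_le (f : SiteY i → ℝ) (E : BallY 𝔸) {γ C : ℝ} (hC : 0 ≤ C)
    (h3 : ∀ z : SiteY i, |((perLapT (toKT i).NB * (toKT i).G) *ᵥ f) z| ≤
      C * wNormS i γ f * (((ℓ : ℝ) + 1) ^ (i.D.lev z.1) * |i.cf|⁻¹) ^ γ) :
    wNormSY i γ (lapS i (fun _ _ => 1) (O (fun _ _ => 1) (liftY f (E : 𝔸)))) ≤ C * wNormS i γ f := by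
  refine wNormSY_le_of_pointwise i (mul_nonneg hC (wNormS_nonneg i γ f)) fun z => ?_
  rw [hO, lapS_one_liftY, Matrix.mulVec_mulVec]
  exact (norm_liftY_le _ E z).trans (h3 z)

end Letter

/-! ## §4 At a member: the (3.47) slot of def-Y's layer at `U = 1` on a site argument -/

section Member

variable {G : Subgroup 𝔸ˣ} (x : MemberY d ℓ hd hL b₀ b₁ Mstar) (𝔏 : CovLettersY 𝔸 x) (𝔈 : ExpLettersY 𝔸 G x)

omit [CompleteSpace 𝔸] in
/-- **the members of record live in print's units**: `η = L^{−k}` of the reading (`etaS`) IS `|c_f|⁻¹` of the (3.41) weights (`MemberY.hcfk`).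
[cite: Balaban1984PropagatorsII, (2.1) p.224 («η = L^{−k}»); Balaban1985BackgroundPropagators, (3.41) p.397] -/
theorem etaS_toKIdx : etaS x.toKIdx = |x.cf|⁻¹ := by
  unfold etaS nKT
  rw [x.hcfk, abs_of_nonneg (by positivity)]
  push_cast
  rfl

/-- the (3.47) slot of def-Y's layer at `U = 1` on a site argument, unfolded (the reading `kernelFamilyS.glob` on `.inl f`).
[cite: Balaban1985BackgroundPropagators, (3.47) p.398 (the reading; bookkeeping)] -/
theorem Gp_glob_one_inl (n : Fin 4) (f : SiteY x.toKIdx → ℝ) (γ : ℝ) :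
    (operatorLayerYOfLetters 𝔸 G x 𝔏 𝔈).Gp.glob n (bg9Y 𝔸 G x).one (Sum.inl f) γ =
      ⨆ E : BallY 𝔸,
        ((![wNormSY x.toKIdx (2 + γ) (fun z => ((etaS x.toKIdx ^ 2 : ℝ) : ℂ) • 𝔏.Gp (fun _ _ => 1) (liftY f (E : 𝔸)) z),
            ⨆ μ : Fin (d + 1), wNormSY x.toKIdx (1 + γ)
              (fun z => ((etaS x.toKIdx : ℝ) : ℂ) • cdS x.toKIdx (fun _ _ => 1) μ (𝔏.Gp (fun _ _ => 1) (liftY f (E : 𝔸))) z),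
            ⨆ μ : Fin (d + 1), wNormSY x.toKIdx (1 + γ)
              (fun z => ((etaS x.toKIdx : ℝ) : ℂ) • 𝔏.Gp (fun _ _ => 1) (cdsS x.toKIdx (fun _ _ => 1) μ (liftY f (E : 𝔸))) z),
            wNormSY x.toKIdx γ (lapS x.toKIdx (fun _ _ => 1) (𝔏.Gp (fun _ _ => 1) (liftY f (E : 𝔸))))] : Fin 4 → ℝ) n) := rfl

/-- ★ **THE (3.47) SLOT OF def-Y's LAYER AT `U = 1` ON A SITE ARGUMENT IS `≤ C|f|_{(γ)}`** given §2's four pointwise bounds for `f` at `γ` (every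
entry `n`, every letter record `𝔏`: flatness clause `𝔏.Gp_one`, sup over the unit ball by def-Y's `iSup_ball_le`).
[cite: Balaban1985BackgroundPropagators, (3.47) p.398 + Cor. 3.5 p.407; Balaban1984PropagatorsII, Prop. 2.2 (2.67) + Lemma 2.1 p.234] -/
theorem Gp_glob_one_inl_le (n : Fin 4) (f : SiteY x.toKIdx → ℝ) {γ C : ℝ} (hC : 0 ≤ C)
    (h : ∀ z : SiteY x.toKIdx,
      |x.cf|⁻¹ ^ 2 * |((toKT x.toKIdx).G *ᵥ f) z| ≤
          C * wNormS x.toKIdx γ f * (((ℓ : ℝ) + 1) ^ (x.D.lev z.1) * |x.cf|⁻¹) ^ ((2 : ℝ) + γ) ∧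
      (∀ μ : Fin (d + 1), |x.cf|⁻¹ * |((dT (toKT x.toKIdx).NB μ * (toKT x.toKIdx).G) *ᵥ f) z| ≤
          C * wNormS x.toKIdx γ f * (((ℓ : ℝ) + 1) ^ (x.D.lev z.1) * |x.cf|⁻¹) ^ ((1 : ℝ) + γ)) ∧
      (∀ μ : Fin (d + 1), |x.cf|⁻¹ * |(((toKT x.toKIdx).G * (dT (toKT x.toKIdx).NB μ)ᵀ) *ᵥ f) z| ≤
          C * wNormS x.toKIdx γ f * (((ℓ : ℝ) + 1) ^ (x.D.lev z.1) * |x.cf|⁻¹) ^ ((1 : ℝ) + γ)) ∧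
      |((perLapT (toKT x.toKIdx).NB * (toKT x.toKIdx).G) *ᵥ f) z| ≤
          C * wNormS x.toKIdx γ f * (((ℓ : ℝ) + 1) ^ (x.D.lev z.1) * |x.cf|⁻¹) ^ γ) :
    (operatorLayerYOfLetters 𝔸 G x 𝔏 𝔈).Gp.glob n (bg9Y 𝔸 G x).one (Sum.inl f) γ ≤ C * wNormS x.toKIdx γ f := by
  have hCN : 0 ≤ C * wNormS x.toKIdx γ f := mul_nonneg hC (wNormS_nonneg _ γ f)
  rw [Gp_glob_one_inl]
  refine iSup_ball_le (fun E => ?_) hCN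
  fin_cases n
  · exact glob0_one_le x.toKIdx 𝔏.Gp 𝔏.Gp_one (etaS_toKIdx x) f E hC (fun z => (h z).1)
  · exact Real.iSup_le (fun μ => glob1_one_le x.toKIdx 𝔏.Gp 𝔏.Gp_one (etaS_toKIdx x) f E μ hC (fun z => (h z).2.1 μ)) hCN
  · exact Real.iSup_le (fun μ => glob2_one_le x.toKIdx 𝔏.Gp 𝔏.Gp_one (etaS_toKIdx x) f E μ hC (fun z => (h z).2.2.1 μ)) hCN
  · exact glob3_one_le x.toKIdx 𝔏.Gp 𝔏.Gp_one f E hC (fun z => (h z).2.2.2)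

end Member

/-! ## §5 The (3.47) leaf of G′(1) at the layer of letters; row 11 from the four remaining leaves -/

section Layer

variable {G : Subgroup 𝔸ˣ} (𝔏 : ∀ x : MemberY d ℓ hd hL b₀ b₁ Mstar, CovLettersY 𝔸 x)
  (𝔈 : ∀ x : MemberY d ℓ hd hL b₀ b₁ Mstar, ExpLettersY 𝔸 G x)

/-- ★★ **THE (3.47) LEAF OF G′(1) ON SITE ARGUMENTS HOLDS AT NODE 00's LAYER OF LETTERS** — for EVERY family of letter records `𝔏` (printed `U = 1`
clause `Gp_one`) and expansion letters `𝔈`: ONE threshold `M₁` and ONE `B₀` such that at every member of Stage 3′(Y) above the threshold, for every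
site argument `λ = .inl f`, every `γ ∈ [−4, 4]` and every entry, `(ops x).Gp.glob n 1 λ γ ≤ B₀|λ|_{(γ)}` — (3.47) at `U = 1` for G′, from [4] (2.67) +
Lemma 2.1 on the torus (lit-balaban-p21) read through def-Y's reading.  The schema `B9ResidualEntriesAtOne.AtOneGlobOn … (fun _ lam => ¬ lam.isRight)`
of row 11 is thereby a THEOREM at this layer. [cite: Balaban1985BackgroundPropagators, Thm 3.1 (3.47) p.398 («consequences of the local ones (3.42) and Lemma 2.1») + Cor. 3.5 p.407; Balaban1984PropagatorsII, Prop. 2.2 (2.67), Lemma 2.1 p.234] -/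
theorem atOneGlobOn_Gp_letters :
    AtOneGlobOn geo9Y (bg9Y 𝔸 G) (fun x => (operatorLayerYOfLetters 𝔸 G x (𝔏 x) (𝔈 x)).Gp) (fun _ lam => ¬ (lam.isRight = true)) := by
  obtain ⟨M₁, C, hM₁, hC, H⟩ := ineq347_Gp_kIdx (d := d) (ℓ := ℓ) (hd := hd) (hL := hL) (b₀ := b₀) (b₁ := b₁) 4
  refine ⟨M₁, C, hM₁, hC, fun x hx n lam γ hP hγ₁ hγ₂ => ?_⟩
  cases lam with
  | inr J => exact absurd rfl hP
  | inl f =>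
      exact Gp_glob_one_inl_le x (𝔏 x) (𝔈 x) n f hC.le (fun z => H x.toKIdx hx γ (abs_le.2 ⟨by linarith, hγ₂⟩) f z)

/-- ★ **THE UNRESTRICTED (3.47) BLOCK OF G′(1) AT U = 1 HOLDS AT THE LAYER OF LETTERS** (`B9FromB6.ResidualGAGlobAtOne`-shape for `(ops ·).Gp`: every
argument, site or bond — OFF the site summand the reading is `0`, `B9ResidualEntriesAtOneAtLetters`).
[cite: Balaban1985BackgroundPropagators, Thm 3.1 (3.47) p.398 + Cor. 3.5 p.407; Balaban1984PropagatorsII, Prop. 2.2 (2.67), Lemma 2.1 p.234] -/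
theorem residualGlobAtOne_Gp_letters :
    ResidualGAGlobAtOne geo9Y (bg9Y 𝔸 G) (fun x => (operatorLayerYOfLetters 𝔸 G x (𝔏 x) (𝔈 x)).Gp) :=
  residualGAGlobAtOne_of_globOn_of_null (fun x => B9GeoNormsKLevelModelSignsV1.modelSignsOn_geo9K x.toKIdx)
    (fun x n lam γ hP => Gp_glob_nonpos_of_isRight x (𝔏 x) (𝔈 x) n _ lam (Classical.not_not.mp hP) γ)
    (atOneGlobOn_Gp_letters 𝔏 𝔈)

/-- ★★ **ROW `hGp` AT THE LAYER OF LETTERS FROM THE FOUR REMAINING U = 1 LEAVES OF G′(1) ON SITE ARGUMENTS** — (3.46), (3.43) with Δ̃-cut-offs, (3.44),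
(3.45) (the printed-shape schemas of `B9ResidualEntriesAtOne`; for G′(1) the cell's G-B9-03a ∕ G-B9-20, not printed in [4]); the (3.47) leaf is
`atOneGlobOn_Gp_letters`, the OFF-summand nulls are `B9ResidualEntriesAtOneAtLetters`'. [cite: Balaban1985BackgroundPropagators, Cor. 3.5 p.407 + Thm 3.1 (3.43)–(3.47) p.398] -/
theorem residualGpAtOne_letters_of_blocksOn4
    (hL2 : AtOneL2On geo9Y (bg9Y 𝔸 G) (fun x => (operatorLayerYOfLetters 𝔸 G x (𝔏 x) (𝔈 x)).Gp) (fun _ lam => ¬ (lam.isRight = true)))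
    (hH1 : AtOneH1On geo9Y (bg9Y 𝔸 G) (fun x => (operatorLayerYOfLetters 𝔸 G x (𝔏 x) (𝔈 x)).Gp) (fun _ lam => ¬ (lam.isRight = true)))
    (hE4 : AtOneE4On geo9Y (bg9Y 𝔸 G) (fun x => (operatorLayerYOfLetters 𝔸 G x (𝔏 x) (𝔈 x)).Gp) (fun _ lam => ¬ (lam.isRight = true)))
    (hH2 : AtOneH2On geo9Y (bg9Y 𝔸 G) (fun x => (operatorLayerYOfLetters 𝔸 G x (𝔏 x) (𝔈 x)).Gp) (fun _ lam => ¬ (lam.isRight = true))) :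
    ResidualGpAtOne geo9Y (bg9Y 𝔸 G) (fun x => (operatorLayerYOfLetters 𝔸 G x (𝔏 x) (𝔈 x)).Gp) :=
  residualGpAtOne_letters_of_blocksOn 𝔏 𝔈 hL2 (atOneGlobOn_Gp_letters 𝔏 𝔈) hH1 hE4 hH2

end Layer

/-! ## §6 At the record: `ops := opsYOfLetters N θ M⋆ 𝔏 𝔈` -/

section Record

open scoped Matrix.Norms.L2Operator

variable (N : ℕ) (θ : Stage3Params) (Mstar' : ℕ) (𝔏 : LettersY N θ Mstar') (𝔈 : ExpsY N θ Mstar')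

/-- ★★ **THE (3.47) LEAF OF G′(1) AT THE RECORD's LAYER OF LETTERS** (`ops := opsYOfLetters N θ M⋆ 𝔏 𝔈`, `𝔸 = M_N(ℂ)`, `G = SU(N)`), every `𝔏 𝔈`.
[cite: Balaban1985BackgroundPropagators, Thm 3.1 (3.47) p.398 + Cor. 3.5 p.407; Balaban1984PropagatorsII, Prop. 2.2 (2.67), Lemma 2.1 p.234] -/
theorem atOneGlobOn_Gp_opsYOfLetters :
    AtOneGlobOn geo9Y (bg9Y (Matrix (Fin N) (Fin N) ℂ) (specialUnitaryUnits (Fin N))) (fun x => (opsYOfLetters N θ Mstar' 𝔏 𝔈 x).Gp)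
      (fun _ lam => ¬ (lam.isRight = true)) :=
  atOneGlobOn_Gp_letters 𝔏 𝔈

/-- ★ the unrestricted (3.47) block of G′(1) at U = 1 at the record's layer of letters. [cite: Balaban1985BackgroundPropagators, Thm 3.1 (3.47) p.398 + Cor. 3.5 p.407] -/
theorem residualGlobAtOne_Gp_opsYOfLetters :
    B9FromB6.ResidualGAGlobAtOne geo9Y (bg9Y (Matrix (Fin N) (Fin N) ℂ) (specialUnitaryUnits (Fin N)))
      (fun x => (opsYOfLetters N θ Mstar' 𝔏 𝔈 x).Gp) :=
  residualGlobAtOne_Gp_letters 𝔏 𝔈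

/-- ★★ **THE KNIT BINDER `hGp` AT NODE 00's OPERATOR LAYER OF LETTERS FROM THE FOUR REMAINING U = 1 LEAVES OF G′(1) ON SITE ARGUMENTS** — conclusion
LITERALLY the binder `hGp` of `Summit.…b9_main_of_up_view₁₁B10YZW_of_obligations` at `ops := opsYOfLetters N θ M⋆ 𝔏 𝔈`; hypotheses = the printed-shape
leaves (3.46) ∕ (3.43)Δ̃ ∕ (3.44) ∕ (3.45) for G′(1) on site arguments (G-B9-03a ∕ G-B9-20); the (3.47) leaf is PROVED (this file).
[cite: Balaban1985BackgroundPropagators, Cor. 3.5 p.407 + Thm 3.1 (3.43)–(3.47) p.398; Balaban1984PropagatorsII, Prop. 2.2 (2.67), Lemma 2.1 p.234] -/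
theorem hGp_opsYOfLetters_of_blocksOn4
    (hL2 : AtOneL2On geo9Y (bg9Y (Matrix (Fin N) (Fin N) ℂ) (specialUnitaryUnits (Fin N))) (fun x => (opsYOfLetters N θ Mstar' 𝔏 𝔈 x).Gp)
      (fun _ lam => ¬ (lam.isRight = true)))
    (hH1 : AtOneH1On geo9Y (bg9Y (Matrix (Fin N) (Fin N) ℂ) (specialUnitaryUnits (Fin N))) (fun x => (opsYOfLetters N θ Mstar' 𝔏 𝔈 x).Gp)
      (fun _ lam => ¬ (lam.isRight = true)))
    (hE4 : AtOneE4On geo9Y (bg9Y (Matrix (Fin N) (Fin N) ℂ) (specialUnitaryUnits (Fin N))) (fun x => (opsYOfLetters N θ Mstar' 𝔏 𝔈 x).Gp)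
      (fun _ lam => ¬ (lam.isRight = true)))
    (hH2 : AtOneH2On geo9Y (bg9Y (Matrix (Fin N) (Fin N) ℂ) (specialUnitaryUnits (Fin N))) (fun x => (opsYOfLetters N θ Mstar' 𝔏 𝔈 x).Gp)
      (fun _ lam => ¬ (lam.isRight = true))) :
    B9FromB6.ResidualGpAtOne geo9Y (bg9Y (Matrix (Fin N) (Fin N) ℂ) (specialUnitaryUnits (Fin N))) (fun x => (opsYOfLetters N θ Mstar' 𝔏 𝔈 x).Gp) :=
  residualGpAtOne_letters_of_blocksOn4 𝔏 𝔈 hL2 hH1 hE4 hH2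

end Record

end Literature.MathematicalPhysics.QuantumFieldTheory.Balaban1983to89.B9Ineq347GpAtLetters

end
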